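import Summits.Ventures.HSemireg.WedgeHankelRecurrenceCensus

/-!
# Venture HSemireg — THE AFFINE CLASSES ARE THE REDUCED SYMBOLS: for `2d ≤ N + 1` the affine classes of middle rank `d` on `[0, N]` are in BIJECTION with the pairs `(m, a)`, `m` monic of
# degree `d`, `deg a < d`, `gcd(m, a) = 1` (the proper rational functions `a / m` of exact degree `d`), via `(m, a) ↦ dualSeq m a`; hence, by the census of N44, **over a finite field with
# `s` elements there are exactly `(s − 1)·s^{2d−1}` such coprime pairs (`d ≥ 1`)** — the totient sum `Σ_{m monic, deg m = d} |(K[X]/(m))ˣ| = s^{2d} − s^{2d−1}` counted through Hankel matrices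

HONEST FRAMING. Part of the Lean index of the computation cell `pub-hsemireg` (seat p10 gen 28, Sunday typer «UNIFORM-IN-n»).
LINEAR ALGEBRA OF HANKEL (catalecticant) MATRICES and of polynomials over a field ONLY: no variety, no cohomology theory, no sheaf, no Ext group and no semiregularity map is constructed
here; nothing here says that HC / HC_CM / HC_AV holds; no Literature fact is declared or used.  Custodian versions as in `WedgeHankelSiegelIdeal` (1/3); the dictionary (affine class =
apolar scheme in the affine line, N43; `dualSeq m a` = the class of the symbol `a / m`, N32) is QUOTED, never asserted.  READING (classical, not used): counting coprime pairs of
polynomials over a finite field against nonsingular Hankel ∕ Toeplitz matrices is García-Armas–Ghorpade–Ram (J. Combin. Theory Ser. A 118 (2011), arXiv:1011.1760); the count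
`s^{2d} − s^{2d−1}` of pairs `(m monic of degree d, a mod m a unit)` is the totient sum of `F_s[X]`; that two monic polynomials of degree `d` over `F_q` are coprime with probability
`1 − 1/q` is classical (e.g. Corteel–Savage–Wilf–Zeilberger, JCTA 1998; GGR 2011 §1).

WHAT IS KEYED / IN THE TREE.  N44 (`WedgeHankelRecurrenceCensus`, p10 g28 claim #2): `seqOf`, `seqOf_apply_of_lt`, `ncard_setOf_isAffineClass`, `ncard_setOf_isAffineClass_zero`; N43 (claim #1):
`IsAffineClass`, `isAffineClass_congr`; N34 (№ 267) `rank_half_eq_and_mem_recSpace_iff_exists_affine`; N32 (№ 263): `dualSeq`, `mem_recSpace_dualSeq`, `dualSeq_unique`,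
`rank_hankel1_half_dualSeq_of_isCoprime`, `recSpace_dualSeq_self_eq_span_of_isCoprime`; N40 (№ 273) `exists_monic_mem_recSpace'`; N23 (№ 176) `recSpace_congr`.  Mathlib:
`Set.ncard_congr`, `Submodule.mem_span_singleton`, `Polynomial.degreeLT`.
THIS FILE (namespace `Summit.Ventures.HSemireg.Wedge.HankelOuter` continued; CHAINED on N44 (and through it N43); 2 definitions `reducedSymbols`, `coprimeMonicPairs`):
* §552 `reducedSymbols K d` = `{(m, a) | m monic, deg m = d, a ∈ K[X]_{<d}, IsCoprime m a}`; `isAffineClass_dualSeq` (the class of a reduced symbol of degree `d` is affine of rank `d`),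
  `eq_of_span_singleton_eq_of_monic` (two monic generators of one line coincide), **`dualSeq_injective_of_isCoprime`** (reduced symbols with the same class on `[0, N]`, `d ≤ N + 1`,
  `2d ≤ N + 1`, are equal), **`exists_reducedSymbol_of_isAffineClass`** (every affine class of rank `d` is `dualSeq m a` on `[0, N]` for a reduced symbol; N34 + N40's normalisation).
* §553 THE BIJECTION **`ncard_reducedSymbols_eq_ncard_setOf_isAffineClass`** (`2d ≤ N + 1`: `#reducedSymbols d = A_N(d)`); THE COUNT **`ncard_reducedSymbols`** (`[Finite K]`, `d ≥ 1`:
  `#reducedSymbols d = (s − 1)·s^{2d−1}`), `ncard_reducedSymbols_zero` (`= 1`: the pair `(1, 0)`).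
* §554 `coprimeMonicPairs K d`; **`ncard_coprimeMonicPairs_eq_ncard_reducedSymbols`** (`(m, a) ↦ (m, m + a)`); **`ncard_coprimeMonicPairs`** (`d ≥ 1`: exactly `(s − 1)·s^{2d−1}` of the
  `s^{2d}` ordered pairs of monic polynomials of degree `d` are coprime — probability `1 − 1/s`).
READING: with N44 this identifies the census columns: `A_N(r)` = reduced symbols of degree `r` (independent of `N` for the obvious reason), `P_N(r)` = symbols of degree `< r` plus a
polar part; the `F_s`-count of reduced symbols is the totient sum.  Nothing Ext-side.  New names only.
-/

open Module Polynomial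
open scoped Matrix Polynomial

namespace Summit.Ventures.HSemireg.Wedge.HankelOuter

open Summit.Ventures.HSemireg.Wedge Summit.Ventures.HSemireg.Wedge.Hankel

variable (K : Type*) [Field K] {N : ℕ}

/-! ## §552. Reduced symbols of degree `d` and affine classes of rank `d` -/

/-- THE REDUCED SYMBOLS OF DEGREE `d`: pairs `(m, a)` with `m` monic of degree `d`, `deg a < d` and `gcd(m, a) = 1` (the proper rational functions `a / m` in lowest terms with denominator
of degree `d`). [definition of this file] -/
def reducedSymbols (d : ℕ) : Set (K[X] × K[X]) := {p | p.1.Monic ∧ p.1.natDegree = d ∧ p.2 ∈ Polynomial.degreeLT K d ∧ IsCoprime p.1 p.2}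

/-- membership spelled out. -/
theorem mem_reducedSymbols_iff {d : ℕ} {p : K[X] × K[X]} : p ∈ reducedSymbols K d ↔ p.1.Monic ∧ p.1.natDegree = d ∧ p.2 ∈ Polynomial.degreeLT K d ∧ IsCoprime p.1 p.2 := Iff.rfl

/-- **the class of a reduced symbol of degree `d` is affine of rank `d`** (`2d ≤ N + 1`; N32). -/
theorem isAffineClass_dualSeq {m a : K[X]} (hm : m.Monic) (hcop : IsCoprime m a) (h2 : m.natDegree + m.natDegree ≤ N + 1) : IsAffineClass K N m.natDegree (dualSeq K m a) :=
  ⟨rank_hankel1_half_dualSeq_of_isCoprime K hm hcop h2, m, mem_recSpace_dualSeq K hm a, hm.ne_zero, rfl⟩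

/-- two monic generators of the same line coincide. -/
theorem eq_of_span_singleton_eq_of_monic {m m' : K[X]} (hm : m.Monic) (hm' : m'.Monic) (h : (K ∙ m : Submodule K K[X]) = K ∙ m') : m = m' := by
  have hmem : m' ∈ (K ∙ m : Submodule K K[X]) := by rw [h]; exact Submodule.mem_span_singleton_self m'
  obtain ⟨c, hc⟩ := Submodule.mem_span_singleton.mp hmem
  have hlc := congrArg Polynomial.leadingCoeff hc
  rw [Polynomial.smul_eq_C_mul, Polynomial.leadingCoeff_mul, Polynomial.leadingCoeff_C, hm.leadingCoeff, hm'.leadingCoeff, mul_one] at hlc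
  rw [← hc, hlc, one_smul]

/-- **REDUCED SYMBOLS WITH THE SAME CLASS ON `[0, N]` ARE EQUAL** (`m`, `m′` monic of degree `d`, `a`, `a′` units of degree `< d`, `2d ≤ N + 1`): the minimal recurrence line recovers
`m` (N32), then N32's `dualSeq_unique` recovers `a`. -/
theorem dualSeq_injective_of_isCoprime {d : ℕ} {m a m' a' : K[X]} (hm : m.Monic) (hmd : m.natDegree = d) (ha : a ∈ Polynomial.degreeLT K d) (hcop : IsCoprime m a)
    (hm' : m'.Monic) (hmd' : m'.natDegree = d) (ha' : a' ∈ Polynomial.degreeLT K d) (hcop' : IsCoprime m' a') (h2 : d + d ≤ N + 1)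
    (h : ∀ j ≤ N, dualSeq K m a j = dualSeq K m' a' j) : m = m' ∧ a = a' := by
  have hrec : recSpace K N (dualSeq K m a) d = recSpace K N (dualSeq K m' a') d := recSpace_congr K h d
  have hmm' : m = m' := by
    refine eq_of_span_singleton_eq_of_monic K hm hm' ?_
    rw [← recSpace_dualSeq_self_eq_span_of_isCoprime K (N := N) hm hcop (by omega), ← recSpace_dualSeq_self_eq_span_of_isCoprime K (N := N) hm' hcop' (by omega), hmd, hmd', hrec]
  subst hmm'
  exact ⟨rfl, dualSeq_unique K hm (by omega) (hmd ▸ ha) (hmd ▸ ha') h⟩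

/-- **EVERY AFFINE CLASS OF RANK `d` IS THE CLASS OF A REDUCED SYMBOL OF DEGREE `d` on `[0, N]`** (`2d ≤ N + 1`; N40's normalisation + N34's structure theorem). -/
theorem exists_reducedSymbol_of_isAffineClass {d : ℕ} {q : ℕ → K} (hA : IsAffineClass K N d q) (h2 : d + d ≤ N + 1) :
    ∃ p ∈ reducedSymbols K d, ∀ j ≤ N, q j = dualSeq K p.1 p.2 j := by
  obtain ⟨hq, m, hm, hm0, hmd⟩ := hA
  obtain ⟨m₁, hmo, hdeg, hm₁, -⟩ := exists_monic_mem_recSpace' K hm hm0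
  rw [hmd] at hdeg
  obtain ⟨a, hcop, ha, h⟩ := (rank_half_eq_and_mem_recSpace_iff_exists_affine K (N := N) hmo (by rw [hdeg]; exact h2) q).mp ⟨by rw [hdeg]; exact hq, by rw [hdeg]; exact hm₁⟩
  exact ⟨(m₁, a), ⟨hmo, hdeg, hdeg ▸ ha, hcop⟩, h⟩

/-! ## §553. The bijection with the affine classes and the count of reduced symbols -/

/-- **THE AFFINE CLASSES OF RANK `d` ARE THE REDUCED SYMBOLS OF DEGREE `d`: for `2d ≤ N + 1`, `#reducedSymbols d = A_N(d)`** (`(m, a) ↦` the coefficient vector of `dualSeq m a` on `[0, N]`). -/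
theorem ncard_reducedSymbols_eq_ncard_setOf_isAffineClass {d : ℕ} (h2 : d + d ≤ N + 1) :
    (reducedSymbols K d).ncard = {v : Fin (N + 1) → K | IsAffineClass K N d (seqOf K v)}.ncard := by
  refine Set.ncard_congr (fun p _ => fun i : Fin (N + 1) => dualSeq K p.1 p.2 i) ?_ ?_ ?_
  · rintro ⟨m, a⟩ ⟨hm, hmd, ha, hcop⟩
    have hagree : ∀ j ≤ N, seqOf K (fun i : Fin (N + 1) => dualSeq K m a i) j = dualSeq K m a j := fun j hj => by
      rw [seqOf_apply_of_lt K _ (show j < N + 1 by omega)]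
    rw [Set.mem_setOf_eq, isAffineClass_congr K hagree, ← hmd]
    exact isAffineClass_dualSeq K hm hcop (by rw [hmd]; exact h2)
  · rintro ⟨m, a⟩ ⟨m', a'⟩ ⟨hm, hmd, ha, hcop⟩ ⟨hm', hmd', ha', hcop'⟩ h
    obtain ⟨rfl, rfl⟩ := dualSeq_injective_of_isCoprime K hm hmd ha hcop hm' hmd' ha' hcop' h2 fun j hj => by
      have := congrFun h ⟨j, by omega⟩
      exact this
    rfl
  · intro v hv
    obtain ⟨p, hp, h⟩ := exists_reducedSymbol_of_isAffineClass K hv h2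
    refine ⟨p, hp, funext fun i => ?_⟩
    rw [← h i (by have := i.2; omega), seqOf_apply_of_lt K v i.2]

/-- **THE NUMBER OF REDUCED SYMBOLS OF DEGREE `d ≥ 1` OVER A FINITE FIELD WITH `s` ELEMENTS IS `(s − 1)·s^{2d−1}`** — the pairs `(m, a)`, `m` monic of degree `d`, `deg a < d`,
`gcd(m, a) = 1` (N44's `A_{2d−1}(d)`; the totient sum `Σ_{deg m = d} |(K[X]/(m))ˣ| = s^{2d} − s^{2d−1}`). -/
theorem ncard_reducedSymbols [Finite K] {d : ℕ} (hd : 1 ≤ d) : (reducedSymbols K d).ncard = (Nat.card K - 1) * Nat.card K ^ (2 * d - 1) := by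
  rw [ncard_reducedSymbols_eq_ncard_setOf_isAffineClass K (N := d + d - 1) (by omega)]
  exact ncard_setOf_isAffineClass K hd (by omega)

/-- `d = 0`: the single pair `(1, 0)`. -/
theorem ncard_reducedSymbols_zero : (reducedSymbols K 0).ncard = 1 := by
  rw [ncard_reducedSymbols_eq_ncard_setOf_isAffineClass K (N := 0) (by omega)]
  exact ncard_setOf_isAffineClass_zero K 0

/-! ## §554. Two monic polynomials of degree `d`: coprime with probability exactly `1 − 1/s` -/

/-- THE ORDERED PAIRS OF COPRIME MONIC POLYNOMIALS OF DEGREE `d`. [definition of this file] -/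
def coprimeMonicPairs (d : ℕ) : Set (K[X] × K[X]) := {p | p.1.Monic ∧ p.2.Monic ∧ p.1.natDegree = d ∧ p.2.natDegree = d ∧ IsCoprime p.1 p.2}

/-- **`(m, a) ↦ (m, m + a)` is a bijection from the reduced symbols of degree `d` onto the ordered pairs of coprime monic polynomials of degree `d`** (`gcd(m, m + a) = gcd(m, a)`;
the difference of two monic polynomials of degree `d` has degree `< d`). -/
theorem ncard_coprimeMonicPairs_eq_ncard_reducedSymbols (d : ℕ) : (coprimeMonicPairs K d).ncard = (reducedSymbols K d).ncard := by
  symm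
  refine Set.ncard_congr (fun p _ => (p.1, p.1 + p.2)) ?_ ?_ ?_
  · rintro ⟨m, a⟩ ⟨hm, hmd, ha, hcop⟩
    dsimp only at hm hmd ha hcop ⊢
    have hdeg : a.degree < m.degree := by
      rw [Polynomial.degree_eq_natDegree hm.ne_zero, hmd]; exact Polynomial.mem_degreeLT.mp ha
    refine ⟨hm, hm.add_of_left hdeg, hmd, ?_, by rw [show m + a = a + m * 1 by ring]; exact hcop.add_mul_left_right 1⟩
    rw [← hmd]
    exact Polynomial.natDegree_add_eq_left_of_degree_lt hdeg
  · rintro ⟨m, a⟩ ⟨m', a'⟩ - - h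
    dsimp only at h
    obtain ⟨rfl, h2⟩ := Prod.mk.inj h
    rw [add_right_inj] at h2
    rw [h2]
  · rintro ⟨m, m'⟩ ⟨hm, hm', hmd, hmd', hcop⟩
    dsimp only at hm hm' hmd hmd' hcop ⊢
    refine ⟨(m, m' - m), ⟨hm, hmd, ?_, ?_⟩, by simp only [add_sub_cancel]⟩
    · rcases eq_or_ne (m' - m) 0 with h0 | h0
      · rw [h0]; exact Submodule.zero_mem _
      · rw [Polynomial.mem_degreeLT, ← hmd', ← Polynomial.degree_eq_natDegree hm'.ne_zero]
        exact Polynomial.degree_sub_lt (by rw [Polynomial.degree_eq_natDegree hm'.ne_zero, Polynomial.degree_eq_natDegree hm.ne_zero, hmd, hmd']) hm'.ne_zero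
          (by rw [hm.leadingCoeff, hm'.leadingCoeff])
    · rw [show m' - m = m' + m * (-1) by ring]
      exact hcop.add_mul_left_right (-1)

/-- **TWO MONIC POLYNOMIALS OF DEGREE `d ≥ 1` OVER A FINITE FIELD WITH `s` ELEMENTS ARE COPRIME IN EXACTLY `(s − 1)·s^{2d−1}` OF THE `s^{2d}` CASES** (probability `1 − 1/s`,
independent of `d`) — counted here through the census of Hankel matrices (N44) and the symbol calculus (N32/N34). -/
theorem ncard_coprimeMonicPairs [Finite K] {d : ℕ} (hd : 1 ≤ d) : (coprimeMonicPairs K d).ncard = (Nat.card K - 1) * Nat.card K ^ (2 * d - 1) := by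
  rw [ncard_coprimeMonicPairs_eq_ncard_reducedSymbols, ncard_reducedSymbols K hd]

end Summit.Ventures.HSemireg.Wedge.HankelOuter
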